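import Literature.AlgebraicGeometry.Motives.ZariskiSheafMorphismsOnAffines
import Mathlib.CategoryTheory.Subfunctor.Image
import Mathlib.AlgebraicGeometry.Sites.BigZariski
import HarnessLib

/-!
# A sub-Zariski-sheaf exhausted by a section on affine schemes is exhausted by it everywhere

Topic `AlgebraicGeometry/Motives`; namespace `Literature.AlgebraicGeometry.Motives`.
THEOREMS ONLY (no definition, no named fact, no instance, no `sorry`).

[GortzWedhorn2020, Ch. 8 (8.3) and Exercise 8.1; (8.4) for the use]: in the proof that a Zariski sheaf `F` on `(Sch)` covered by
representable open subfunctors is representable (Thm. 8.9; for the Grassmannian, (8.4)), each chart is a morphism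
`h_X ⟶ F` given by a section `x ∈ F(X)` (Yoneda), and one must identify ITS IMAGE with a sub-sheaf `P ⊆ F` cut out by an open
condition, and prove it INJECTIVE, on every test scheme `T`.  Since `(Aff) ⊂ (Sch)` induces an equivalence of Zariski sheaves
(★ `isEquivalence_sheafPushforwardContinuous_Spec`, whence ★ `isIso_of_bijective_app_Spec`), both statements reduce to AFFINE
test schemes: if `g ↦ F(g)(x) : (Spec A ⟶ X) → P(Spec A)` is bijective for every ring `A`, then the corestriction `h_X ⟶ P` is an
isomorphism of Zariski sheaves (`h_X` is a sheaf because the Zariski topology is subcanonical), so for every `T` the image of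
`h_X(T) → F(T)` is `P(T)` and the map is injective.

* §1 `range_yonedaEquiv_symm_le` — the image of `yonedaEquiv.symm x : h_X ⟶ F` lies in any subfunctor containing `x`;
* §2 **`isIso_lift_yonedaEquiv_symm_of_bijective_Spec`** — the corestriction `h_X ⟶ P` is an isomorphism;
  **`range_yonedaEquiv_symm_app_eq_of_bijective_Spec`**, **`injective_yonedaEquiv_symm_app_of_bijective_Spec`** — the two
  consequences in the shape ★ `isRepresentable_of_openCondition_cover` consumes (`Set.range ((f i).app (op T))`, `hinj`).

Cell `hodgecm-mathlib` (D-0151), F-DAG first hand (h4) «Grassmannian as a scheme» ((A3.3) injectivity of the chart maps and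
(A3.5)(c) «image of the chart map = chart sub-sheaf», both reduced to the affine bijection `(Spec A ⟶ 𝔸) ≃ chart(A)`); generic,
nothing here mentions the Grassmannian.  Count-neutral capital; HC_CM is proved only modulo the 7 printed citations until rung 0 closes.

## References
* [GortzWedhorn2020] U. Görtz, T. Wedhorn, *Algebraic Geometry I*, 2nd ed. (2020), Ch. 8, (8.3), Thm. 8.9 (p. 212), Exercise 8.1.
* [StacksProject] The Stacks project, Tag 01JJ.
-/

namespace Literature.AlgebraicGeometry.Motives

universe u

open CategoryTheory Opposite _root_.AlgebraicGeometry

variable {F : Sheaf Scheme.zariskiTopology.{u} (Type u)} (P : Subfunctor F.obj) {X : Scheme.{u}}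
  (x : F.obj.obj (op X))

/-! ## §1 The corestriction of a Yoneda morphism to a subfunctor -/

/-- The image of the Yoneda morphism `yonedaEquiv.symm x : h_X ⟶ F` of a section `x ∈ P(X)` lies in the subfunctor `P`
(`(yonedaEquiv.symm x)(g) = F(g)(x)` and `P` is stable under `F(g)`). [cite: GortzWedhorn2020, Ch. 8 (8.3)] -/
theorem range_yonedaEquiv_symm_le (hx : x ∈ P.obj (op X)) : Subfunctor.range (yonedaEquiv.symm x) ≤ P := by
  rintro U _ ⟨g, rfl⟩
  rw [yonedaEquiv_symm_app_apply]
  exact P.map g.op hx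

/-! ## §2 Bijective on affine schemes ⇒ isomorphism onto the sub-sheaf -/

/-- **The corestriction `h_X ⟶ P` of the Yoneda morphism of `x ∈ P(X)` is an isomorphism of Zariski sheaves as soon as it is
bijective on every affine scheme** — `P ⊆ F` a sub-Zariski-sheaf, `h_X` a sheaf since the Zariski topology is subcanonical,
★ `isIso_of_bijective_app_Spec`. [cite: GortzWedhorn2020, Ch. 8 Exercise 8.1] -/
theorem isIso_lift_yonedaEquiv_symm_of_bijective_Spec (hP : Presheaf.IsSheaf Scheme.zariskiTopology.{u} P.toFunctor)
    (hx : x ∈ P.obj (op X))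
    (hbij : ∀ A : CommRingCat.{u}, Function.Bijective fun g : Spec A ⟶ X =>
      (⟨F.obj.map g.op x, P.map g.op hx⟩ : P.toFunctor.obj (op (Spec A)))) :
    IsIso (Subfunctor.lift (yonedaEquiv.symm x) (range_yonedaEquiv_symm_le P x hx)) := by
  -- the two sheaves and the morphism between them
  let Y₀ : Sheaf Scheme.zariskiTopology.{u} (Type u) :=
    ⟨yoneda.obj X, (isSheaf_iff_isSheaf_of_type _ _).mpr
      (GrothendieckTopology.Subcanonical.isSheaf_of_isRepresentable (yoneda.obj X))⟩
  let P₀ : Sheaf Scheme.zariskiTopology.{u} (Type u) := ⟨P.toFunctor, hP⟩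
  let φ : Y₀ ⟶ P₀ := ObjectProperty.homMk (Subfunctor.lift (yonedaEquiv.symm x) (range_yonedaEquiv_symm_le P x hx))
  have hφ : IsIso φ := by
    refine isIso_of_bijective_app_Spec φ fun A => ?_
    have heq : (fun g : Spec A ⟶ X => (⟨F.obj.map g.op x, P.map g.op hx⟩ : P.toFunctor.obj (op (Spec A)))) =
        φ.hom.app (op (Spec A)) := by
      funext g
      apply Subtype.ext
      change F.obj.map g.op x = ((yonedaEquiv.symm x).app (op (Spec A)) g)
      rw [yonedaEquiv_symm_app_apply]
    exact heq ▸ hbij A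
  exact (ObjectProperty.isIso_hom_iff φ).mpr hφ

/-- **Image of the chart map = the chart sub-sheaf.**  Under the hypotheses of `isIso_lift_yonedaEquiv_symm_of_bijective_Spec`,
for every scheme `T` the image of `h_X(T) → F(T)`, `g ↦ F(g)(x)`, is exactly `P(T)`.  This is the shape of the hypothesis
`F.1.map h.op x ∈ Set.range ((f i).app (op T'))` of ★ `isRepresentable_of_openCondition_cover`. [cite: GortzWedhorn2020, Thm. 8.9 (p. 212)] -/
theorem range_yonedaEquiv_symm_app_eq_of_bijective_Spec (hP : Presheaf.IsSheaf Scheme.zariskiTopology.{u} P.toFunctor)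
    (hx : x ∈ P.obj (op X))
    (hbij : ∀ A : CommRingCat.{u}, Function.Bijective fun g : Spec A ⟶ X =>
      (⟨F.obj.map g.op x, P.map g.op hx⟩ : P.toFunctor.obj (op (Spec A)))) (T : Scheme.{u}) :
    Set.range ((yonedaEquiv.symm x).app (op T)) = P.obj (op T) := by
  haveI := isIso_lift_yonedaEquiv_symm_of_bijective_Spec P x hP hx hbij
  set l := Subfunctor.lift (yonedaEquiv.symm x) (range_yonedaEquiv_symm_le P x hx)
  have hsurj : Function.Surjective (l.app (op T)) :=
    ((isIso_iff_bijective (l.app (op T))).mp inferInstance).2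
  ext y
  constructor
  · rintro ⟨g, rfl⟩
    exact range_yonedaEquiv_symm_le P x hx (op T) ⟨g, rfl⟩
  · intro hy
    obtain ⟨g, hg⟩ := hsurj ⟨y, hy⟩
    refine ⟨g, ?_⟩
    exact congrArg Subtype.val hg

/-- **Injectivity of the chart map.**  Under the same hypotheses, `g ↦ F(g)(x) : h_X(T) → F(T)` is injective for every `T`
(the hypothesis `hinj` of ★ `isRepresentable_of_openCondition_cover`). [cite: GortzWedhorn2020, Thm. 8.9 (p. 212)] -/
theorem injective_yonedaEquiv_symm_app_of_bijective_Spec (hP : Presheaf.IsSheaf Scheme.zariskiTopology.{u} P.toFunctor)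
    (hx : x ∈ P.obj (op X))
    (hbij : ∀ A : CommRingCat.{u}, Function.Bijective fun g : Spec A ⟶ X =>
      (⟨F.obj.map g.op x, P.map g.op hx⟩ : P.toFunctor.obj (op (Spec A)))) (T : Scheme.{u}) :
    Function.Injective ((yonedaEquiv.symm x).app (op T)) := by
  haveI := isIso_lift_yonedaEquiv_symm_of_bijective_Spec P x hP hx hbij
  set l := Subfunctor.lift (yonedaEquiv.symm x) (range_yonedaEquiv_symm_le P x hx)
  have hinj : Function.Injective (l.app (op T)) :=
    ((isIso_iff_bijective (l.app (op T))).mp inferInstance).1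
  intro g g' h
  apply hinj
  apply Subtype.ext
  exact h

end Literature.AlgebraicGeometry.Motives
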